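import Summits.RiemannHypothesis.RiemannHypothesis.Theorems.WeilTwoPrimeDeflM80FDef
import HarnessLib

/-!
# Deflated two-prime certificate M80F: the value of `κ`, `β₂₃ ≤ κ`, `κ − β₂₃ = κ'`, and the scalar side conditions

`weilCertDeflM80F.kappaQ` evaluated by the kernel, the level identities, and `checkScalars` with `κ` rewritten to its value first. Pure proof file.
-/

set_option linter.dupNamespace false

noncomputable section

namespace Summit.RiemannHypothesis.RiemannHypothesis.Theorems.EvenWinsBeyondArch

open Literature.NumberTheory.LFunctions

set_option maxHeartbeats 0 in
/-- **The value of `κ`** of certificate M80F. [folklore] -/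
theorem kappaQ_weilCertDeflM80F : weilCertDeflM80F.kappaQ = weilCertDeflM80FKappaLit := by
  have h : decide (weilCertDeflM80F.kappaQ = weilCertDeflM80FKappaLit) = true := by decide +kernel
  exact of_decide_eq_true h

/-- `β₂₃ ≤ κ` for certificate M80F. [folklore] -/
theorem beta_le_kappaQ_weilCertDeflM80F : weilCertDeflM80FBeta ≤ weilCertDeflM80F.kappaQ := by
  rw [kappaQ_weilCertDeflM80F]; unfold weilCertDeflM80FBeta weilCertDeflM80FKappaLit; norm_num

/-- `κ − β₂₃ = κ'` for certificate M80F. [folklore] -/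
theorem kappaQ_sub_beta_weilCertDeflM80F : weilCertDeflM80F.kappaQ - weilCertDeflM80FBeta = weilCertDeflM80FKappa' := by
  rw [kappaQ_weilCertDeflM80F]; unfold weilCertDeflM80FBeta weilCertDeflM80FKappaLit weilCertDeflM80FKappa'; norm_num

set_option maxHeartbeats 0 in
/-- **Kernel check of the scalar side conditions** of certificate M80F. [folklore] -/
theorem checkScalars_weilCertDeflM80F : weilCertDeflM80F.checkScalars = true := by
  have h : weilCertDeflM80F.checkScalars = (decide (1 ≤ weilCertDeflM80F.j) && decide (0 < weilCertDeflM80F.b) && decide (weilCertDeflM80F.b ≤ weilCertDeflM80F.base.a0) &&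
      decide (weilCertDeflM80F.base.a0 ≤ 1) && decide (0 < weilCertDeflM80F.base.T) && decide (2 * weilCertDeflM80F.base.a0 * weilCertDeflM80F.base.T ≤ (weilCertDeflM80F.base.N : ℚ) + 2) &&
      decide (2 * (weilCertDeflM80F.base.a0 * weilCertDeflM80F.base.T) ^ (weilCertDeflM80F.base.N + 1) / (weilCertDeflM80F.base.N + 1).factorial ≤ 1) &&
      decide (weilCertDeflM80F.base.N + 1 = 2 * weilCertDeflM80F.base.nb) && decide (0 ≤ weilCertDeflM80F.kappaQ)) := rfl
  rw [h, kappaQ_weilCertDeflM80F]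
  decide +kernel

end Summit.RiemannHypothesis.RiemannHypothesis.Theorems.EvenWinsBeyondArch
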